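import Summits.KontsevichZagierPeriods.KontsevichZagierPeriods.Theorems.TerasomaMultiplicationGammaHodgeSectorStubInstanceCompiler
import Summits.KontsevichZagierPeriods.KontsevichZagierPeriods.Theorems.TerasomaMultiplicationGammaHodgeSectorStubCertificateLift
import Summits.KontsevichZagierPeriods.KontsevichZagierPeriods.Theorems.TerasomaMultiplicationGammaHodgeSectorStubKoCertificatesSixtySix
import Summits.KontsevichZagierPeriods.KontsevichZagierPeriods.Theorems.TerasomaMultiplicationGammaHodgeSectorStubShapeDasThirtyThree
import Summits.KontsevichZagierPeriods.KontsevichZagierPeriods.Theorems.TerasomaMultiplicationGammaHodgeSectorStubPairSixtySix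

/-!
# `GammaHodgeSector` (stmt-KontsevichZagierPeriods-3742) — instance line `InstanceSixtySix`
(idea card `raise-to-66-isogeny`): the certified "Hodge-conjecture-hard" level-33 instances of the
crux lie in the SURFACE sector at level 66 — assembly

For the two level-33 instances which the crux dossier held up as the reason no line can close the
∀-crux — da Silva's class on the Fermat fourfold `X⁴₃₃` (`Negative/Fermat33`: datum
`(N, N', k) = (5, 0, 3)`, `x33`, `y33`, `c33`; `fermat33_of_gammaHodgeSector`) and the "deep"
quadratic pair `DasDeepThirtyThree`, `B(1/33,1/33)B(2/33,22/33) = c·B(1/33,3/33)B(2/33,14/33)` —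
the KZ-equivalence follows from the route's two standing cruxes `MultiplicationAccessible` (12305)
and `BetaCancellation` (13633) and ONE solved linear Beta pair of level 66,
`β(1/22,1/3) = κ(q)·β(1/22,16/33)` in `P` (`q = Γ(1/3)Γ(35/66)/(Γ(25/66)Γ(16/33))`, a CM isogeny
between two factors of `J(F₆₆)`; an instance of `MotivatedMoves.GammaHodgePairs` and of
`FermatIsogeny.BetaLinearSector`), by the landed parametric relator compiler fed with the exact
ℤ-lattice certificates at level 66 (`…StubKoCertificatesSixtySix`: two duplications, one
triplication / one undecimation, reflections), lifted to the symbol group (`…StubCertificateLift`).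

Contents: `symbolDas33_mem`, `symbolFermat33_mem` (UNCONDITIONAL: both level-33 symbols lie in
`RelSpan ⊔ ⟨[1/22,1/3] − [1/22,16/33]⟩`); the three sources of the pair (`GammaHodgePairs` —
`stub_pair66_of_gammaHodgePairs`; `BetaLinearSector` — `pair66_of_betaLinearSector`; the pair as a
bare KZ-equivalence statement — `pair66_of_isogenyPair`); and the instances
`dasDeep33_of_solvedPair66` / `fermat33_of_solvedPair66` (12305 ∧ 13633 ∧ pair ⟹ instance; the
latter is the exact conclusion of `fermat33_of_gammaHodgeSector` WITHOUT the crux) with their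
`…_of_gammaHodgePairs` / `…_of_isogenyPair` corollaries. So the deep residual of the crux (symbols
beyond `RelSpan ⊔ ⟨all linear pairs⟩`) does NOT start at level 33. Nothing here closes the ∀-crux.
References: Deligne LNM 900 §7 (Koblitz–Ogus appendix); Das 2000; da Silva arXiv:2101.04739 Prop. 3.6;
N. Aoki, Amer. J. Math. 113 (1991) 779–833 (exceptional isogenies of Fermat factors).
-/

noncomputable section

open MeasureTheory Set
open scoped BigOperators

namespace Summit.KontsevichZagierPeriods.GammaHodgeSectorRaise66

open Literature.NumberTheory.Transcendental
open Literature.NumberTheory.Transcendental.KZ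
open Literature.NumberTheory.Transcendental.BetaSymbol
open Summit.KontsevichZagierPeriods.GammaHodgeSectorKO
open Summit.KontsevichZagierPeriods.GammaHodgeSectorNegative
open Summit.KontsevichZagierPeriods.KontsevichZagierPeriods.Theses.TerasomaMultiplication
  (GammaHodgeSector MultiplicationAccessible BetaCancellation)
open Summit.KontsevichZagierPeriods.KontsevichZagierPeriods.Theses.MotivatedMoves (GammaHodgePairs)
open Summit.KontsevichZagierPeriods.KontsevichZagierPeriods.Theses.FermatIsogeny (BetaLinearSector)
open Summit.KontsevichZagierPeriods.KontsevichZagierPeriods.BetaCancellationNegative (betaKernel)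

/-! ## Stubs -/

/-- The pair symbol `[1/22,1/3] − [1/22,16/33]` lies in the closure of the image of the solved set.
[folklore] -/
theorem pairSym_mem_closure :
    bsym (1/22) (1/3) - bsym (1/22) (16/33) ∈
      AddSubgroup.closure ((fun p => msym p.1 - msym p.2) ''
        ({(({((1:ℚ)/22, (1:ℚ)/3)} : Multiset (ℚ × ℚ)), ({((1:ℚ)/22, (16:ℚ)/33)} : Multiset (ℚ × ℚ)))} :
          Set (Multiset (ℚ × ℚ) × Multiset (ℚ × ℚ)))) := by
  refine AddSubgroup.subset_closure ⟨_, Set.mem_singleton _, ?_⟩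
  simp only [msym_singleton]

/-- **Symbol certificate, DasDeepThirtyThree**: the symbol of the level-33 quadratic pair lies in
`RelSpan ⊔ ⟨[1/22,1/3] − [1/22,16/33]⟩` (certificate at level 66, lifted). [folklore] -/
theorem symbolDas33_mem :
    wordSym (![1/33, 2/33] : Fin 2 → ℚ) (![1/33, 22/33] : Fin 2 → ℚ)
        - wordSym (![1/33, 2/33] : Fin 2 → ℚ) (![3/33, 14/33] : Fin 2 → ℚ) ∈
      RelSpan ⊔ AddSubgroup.closure ((fun p => msym p.1 - msym p.2) ''
        ({(({((1:ℚ)/22, (1:ℚ)/3)} : Multiset (ℚ × ℚ)), ({((1:ℚ)/22, (16:ℚ)/33)} : Multiset (ℚ × ℚ)))} :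
          Set (Multiset (ℚ × ℚ) × Multiset (ℚ × ℚ)))) := by
  have hrel := stub_certificateLift 66 (by norm_num) _ stub_levelWeight66.1.1 stub_koCertificates66.1
    stub_levelWeight66.1.2
  have h := AddSubgroup.sub_mem (RelSpan ⊔ _) (AddSubgroup.mem_sup_left hrel)
    (AddSubgroup.mem_sup_right pairSym_mem_closure)
  rwa [add_sub_cancel_right] at h

/-- **Symbol certificate, Fermat33**: the symbol of the `(5, 0, 3)` datum of `Negative/Fermat33`
lies in `RelSpan ⊔ ⟨[1/22,1/3] − [1/22,16/33]⟩` (certificate at level 66, lifted). [folklore] -/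
theorem symbolFermat33_mem :
    wordSym x33 y33 - wordSym (Fin.elim0 : Fin 0 → ℚ) (Fin.elim0 : Fin 0 → ℚ)
        - (3:ℕ) • bsym (1 / 2) (1 / 2) ∈
      RelSpan ⊔ AddSubgroup.closure ((fun p => msym p.1 - msym p.2) ''
        ({(({((1:ℚ)/22, (1:ℚ)/3)} : Multiset (ℚ × ℚ)), ({((1:ℚ)/22, (16:ℚ)/33)} : Multiset (ℚ × ℚ)))} :
          Set (Multiset (ℚ × ℚ) × Multiset (ℚ × ℚ)))) := by
  have hrel := stub_certificateLift 66 (by norm_num) _ stub_levelWeight66.2.1 stub_koCertificates66.2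
    stub_levelWeight66.2.2
  have h := AddSubgroup.add_mem_sup hrel pairSym_mem_closure
  rwa [sub_add_cancel] at h

/-! ## Compositions -/

/-- The one-element solved set `{(β(1/22,1/3), β(1/22,16/33))}` holds in `P` as soon as its pair does. [folklore] -/
theorem pair66_solved (hS : IsConstMultiple (betaClass (1/22) (1/3)) (betaClass (1/22) (16/33))) :
    ∀ p ∈ ({(({((1:ℚ)/22, (1:ℚ)/3)} : Multiset (ℚ × ℚ)), ({((1:ℚ)/22, (16:ℚ)/33)} : Multiset (ℚ × ℚ)))} : Set (Multiset (ℚ × ℚ) × Multiset (ℚ × ℚ))), IsConstMultiple (prodClass p.1) (prodClass p.2) := by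
  intro p hp
  rw [Set.mem_singleton_iff] at hp
  subst hp
  simpa only [prodClass_singleton] using hS

/-- **DasDeepThirtyThree, pinned form, from 12305 + 13633 + the level-66 pair.** -/
theorem dasDeep33_canonical_of_solvedPair66 (hM : MultiplicationAccessible) (hB : BetaCancellation)
    (hS : IsConstMultiple (betaClass (1/22) (1/3)) (betaClass (1/22) (16/33)))
    (c : ℝ) (hc : IsAlgebraic ℚ c) (r : IntegralRep 2) (r' : IntegralRep (2 * 0 + 2))
    (hr : IsCubeBetaRep (![1/33, 2/33] : Fin 2 → ℚ) (![1/33, 22/33]) r)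
    (hr' : IsBallCubeRep 0 (![1/33, 2/33] : Fin 2 → ℚ) (![3/33, 14/33]) c r')
    (hv : r.value = r'.value) : Equivalent r r' := by
  refine stub_instanceCompiler hM hB _ (pair66_solved hS) _ _ _ _ c ?_ ?_ hc ?_ r r' hr hr' hv
  · intro j; fin_cases j <;> norm_num
  · intro l; fin_cases l <;> norm_num
  · rw [zero_smul, sub_zero]
    exact symbolDas33_mem

/-- **DasDeepThirtyThree VERBATIM from 12305 + 13633 + the level-66 pair.** -/
theorem dasDeep33_of_solvedPair66 (hM : MultiplicationAccessible) (hB : BetaCancellation)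
    (hS : IsConstMultiple (betaClass (1/22) (1/3)) (betaClass (1/22) (16/33)))
    (c : ℝ) (hc : IsAlgebraic ℚ c) (r r' : IntegralRep 2)
    (hd : r.domain = {x | ∀ i, x i ∈ Set.Ioo (0:ℝ) 1})
    (hi : Set.EqOn r.integrand (fun x => (x 0) ^ (-(32:ℝ)/33) * (1 - x 0) ^ (-(32:ℝ)/33) *
      ((x 1) ^ (-(31:ℝ)/33) * (1 - x 1) ^ (-(11:ℝ)/33))) r.domain)
    (hd' : r'.domain = {x | ∀ i, x i ∈ Set.Ioo (0:ℝ) 1})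
    (hi' : Set.EqOn r'.integrand (fun x => c * ((x 0) ^ (-(32:ℝ)/33) * (1 - x 0) ^ (-(30:ℝ)/33) *
      ((x 1) ^ (-(31:ℝ)/33) * (1 - x 1) ^ (-(19:ℝ)/33)))) r'.domain)
    (hv : r.value = r'.value) : Equivalent r r' :=
  stub_shapeDas33 (dasDeep33_canonical_of_solvedPair66 hM hB hS) c hc r r' hd hi hd' hi' hv

/-- **DasDeepThirtyThree from the divisor range** `GammaHodgePairs` (3743), 12305 and 13633. -/
theorem dasDeep33_of_gammaHodgePairs (hP : GammaHodgePairs) (hM : MultiplicationAccessible)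
    (hB : BetaCancellation)
    (c : ℝ) (hc : IsAlgebraic ℚ c) (r r' : IntegralRep 2)
    (hd : r.domain = {x | ∀ i, x i ∈ Set.Ioo (0:ℝ) 1})
    (hi : Set.EqOn r.integrand (fun x => (x 0) ^ (-(32:ℝ)/33) * (1 - x 0) ^ (-(32:ℝ)/33) *
      ((x 1) ^ (-(31:ℝ)/33) * (1 - x 1) ^ (-(11:ℝ)/33))) r.domain)
    (hd' : r'.domain = {x | ∀ i, x i ∈ Set.Ioo (0:ℝ) 1})
    (hi' : Set.EqOn r'.integrand (fun x => c * ((x 0) ^ (-(32:ℝ)/33) * (1 - x 0) ^ (-(30:ℝ)/33) *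
      ((x 1) ^ (-(31:ℝ)/33) * (1 - x 1) ^ (-(19:ℝ)/33)))) r'.domain)
    (hv : r.value = r'.value) : Equivalent r r' :=
  dasDeep33_of_solvedPair66 hM hB (stub_pair66_of_gammaHodgePairs hP) c hc r r' hd hi hd' hi' hv

/-- **The Fermat-33 certificate instance of `Negative/Fermat33` from 12305 + 13633 + the level-66
pair** — the exact conclusion of `fermat33_of_gammaHodgeSector`, without the crux. -/
theorem fermat33_of_solvedPair66 (hM : MultiplicationAccessible) (hB : BetaCancellation)
    (hS : IsConstMultiple (betaClass (1/22) (1/3)) (betaClass (1/22) (16/33))) :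
    Equivalent (cubeRep x33 y33 admissible_fermat33.pos)
      (ballCubeRep 3 Fin.elim0 Fin.elim0 c33 isAlgebraic_c33 admissible_elim0.pos) :=
  stub_instanceCompiler hM hB _ (pair66_solved hS) x33 y33 Fin.elim0 Fin.elim0 c33
    admissible_fermat33.pos admissible_elim0.pos isAlgebraic_c33 symbolFermat33_mem _ _
    (isCubeBetaRep_cubeRep x33 y33 _) (isBallCubeRep_ballCubeRep 3 Fin.elim0 Fin.elim0 c33 _ _)
    ((valueEq_iff_deligneIdentity admissible_fermat33.pos admissible_elim0.pos
      (isCubeBetaRep_cubeRep x33 y33 _) (isBallCubeRep_ballCubeRep 3 Fin.elim0 Fin.elim0 c33 _ _)).mpr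
      deligneIdentity_fermat33)

/-- The Fermat-33 instance in the crux's verbatim shape, from 12305 + 13633 + the pair. -/
theorem fermat33_of_solvedPair66' (hM : MultiplicationAccessible) (hB : BetaCancellation)
    (hS : IsConstMultiple (betaClass (1/22) (1/3)) (betaClass (1/22) (16/33)))
    (c : ℝ) (hc : IsAlgebraic ℚ c) (r : IntegralRep 5) (r' : IntegralRep (2 * 3 + 0))
    (hr : IsCubeBetaRep x33 y33 r) (hr' : IsBallCubeRep 3 Fin.elim0 Fin.elim0 c r')
    (hv : r.value = r'.value) : Equivalent r r' :=
  stub_instanceCompiler hM hB _ (pair66_solved hS) x33 y33 Fin.elim0 Fin.elim0 c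
    admissible_fermat33.pos admissible_elim0.pos hc symbolFermat33_mem r r' hr hr' hv

/-- **The Fermat-33 instance from the divisor range** `GammaHodgePairs`, 12305 and 13633. -/
theorem fermat33_of_gammaHodgePairs (hP : GammaHodgePairs) (hM : MultiplicationAccessible)
    (hB : BetaCancellation) :
    Equivalent (cubeRep x33 y33 admissible_fermat33.pos)
      (ballCubeRep 3 Fin.elim0 Fin.elim0 c33 isAlgebraic_c33 admissible_elim0.pos) :=
  fermat33_of_solvedPair66 hM hB (stub_pair66_of_gammaHodgePairs hP)

/-! ## The pair from `BetaLinearSector` and from its bare KZ-equivalence statement -/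

/-- **The level-66 pair is solved by the Beta-linear sector** of route `FermatIsogeny`
(`BetaLinearSector`, crux stmt-3897): `β(1/22,1/3) = κ(q)·β(1/22,16/33)` in `P`. [folklore] -/
theorem pair66_of_betaLinearSector (hL : BetaLinearSector) :
    IsConstMultiple (betaClass (1/22) (1/3)) (betaClass (1/22) (16/33)) := by
  refine isConstMultiple_of_betaLinearSector hL (a := 1/22) (b := 1/3) (a' := 1/22) (b' := 16/33)
    (by norm_num) (by norm_num) (by norm_num) (by norm_num) pair66_constant_isAlgebraic ?_
  have h := deligneIdentity_pair66
  unfold DeligneIdentity at h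
  simpa only [Fin.prod_univ_one, Matrix.cons_val_fin_one, pow_zero, mul_one] using h

/-- **The level-66 pair from its bare KZ-equivalence statement** (the card's `IsogenyPairSixtySix`,
an instance of `GammaHodgePairs` at `N = N' = 1`, `k = 0`): if every representation pinned as
`[(0,1), t^{-21/22}(1−t)^{-2/3}]` is equivalent to every equal-valued representation pinned as
`[(0,1), c·t^{-21/22}(1−t)^{-17/33}]` (`c` real algebraic), then `β(1/22,1/3) = κ(q)·β(1/22,16/33)`
in `P`. [folklore] -/
theorem pair66_of_isogenyPair
    (hI : ∀ (c : ℝ), IsAlgebraic ℚ c → ∀ (r r' : IntegralRep 1),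
      r.domain = {t | t 0 ∈ Set.Ioo (0:ℝ) 1} →
      Set.EqOn r.integrand (fun t => (t 0) ^ (-(21:ℝ)/22) * (1 - t 0) ^ (-(2:ℝ)/3)) r.domain →
      r'.domain = {t | t 0 ∈ Set.Ioo (0:ℝ) 1} →
      Set.EqOn r'.integrand (fun t => c * ((t 0) ^ (-(21:ℝ)/22) * (1 - t 0) ^ (-(17:ℝ)/33))) r'.domain →
      r.value = r'.value → Equivalent r r') :
    IsConstMultiple (betaClass (1/22) (1/3)) (betaClass (1/22) (16/33)) := by
  set q : ℝ := Real.Gamma (1/3) * Real.Gamma (35/66) * (Real.Gamma (25/66))⁻¹ * (Real.Gamma (16/33))⁻¹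
    with hqdef
  have hq : IsAlgebraic ℚ q := pair66_constant_isAlgebraic
  have ha : (0:ℚ) < 1/22 := by norm_num
  have hb : (0:ℚ) < 1/3 := by norm_num
  have hb' : (0:ℚ) < 16/33 := by norm_num
  have hD : ProbabilityTheory.beta ((1/22 : ℚ) : ℝ) ((1/3 : ℚ) : ℝ) =
      q * ProbabilityTheory.beta ((1/22 : ℚ) : ℝ) ((16/33 : ℚ) : ℝ) := by
    have h := deligneIdentity_pair66
    unfold DeligneIdentity at h
    simpa only [Fin.prod_univ_one, Matrix.cons_val_fin_one, pow_zero, mul_one] using h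
  set r : IntegralRep 1 := betaRep (1/22) (1/3) ha hb with hr
  set r' : IntegralRep 1 := (betaRep (1/22) (16/33) ha hb').constMul q hq with hr'
  have hv : r.value = r'.value := by
    rw [hr, hr', IntegralRep.value_constMul, betaRep_value, betaRep_value, hD]
  have hEq : Equivalent r r' := by
    refine hI q hq r r' rfl ?_ rfl ?_ hv
    · intro x _
      rw [hr, betaRep_integrand]
      simp only [betaKernel]
      push_cast
      norm_num
    · intro x _
      rw [hr', IntegralRep.integrand_constMul, betaRep_integrand]
      simp only [betaKernel]
      push_cast
      norm_num
  have hq0 : 0 < q := by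
    have h1 : 0 < ProbabilityTheory.beta (((1/22 : ℚ)) : ℝ) ((1/3 : ℚ) : ℝ) :=
      ProbabilityTheory.beta_pos (by norm_num) (by norm_num)
    have h2 : 0 < ProbabilityTheory.beta (((1/22 : ℚ)) : ℝ) ((16/33 : ℚ) : ℝ) :=
      ProbabilityTheory.beta_pos (by norm_num) (by norm_num)
    rw [hD] at h1
    exact (mul_pos_iff_of_pos_right h2).mp h1
  refine ⟨q, hq, hq0, ?_⟩
  rw [betaClass_eq _ _ ha hb, hEq.toFormalPeriod_eq, hr',
    Summit.KontsevichZagierPeriods.TerasomaMultiplication.GammaHodgeFromRelators.toFormalPeriod_of_constMul,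
    ← betaClass_eq _ _ ha hb']

/-- **DasDeepThirtyThree from the Beta-linear sector** (3897), 12305 and 13633. [folklore] -/
theorem dasDeep33_of_betaLinearSector (hL : BetaLinearSector) (hM : MultiplicationAccessible)
    (hB : BetaCancellation)
    (c : ℝ) (hc : IsAlgebraic ℚ c) (r r' : IntegralRep 2)
    (hd : r.domain = {x | ∀ i, x i ∈ Set.Ioo (0:ℝ) 1})
    (hi : Set.EqOn r.integrand (fun x => (x 0) ^ (-(32:ℝ)/33) * (1 - x 0) ^ (-(32:ℝ)/33) *
      ((x 1) ^ (-(31:ℝ)/33) * (1 - x 1) ^ (-(11:ℝ)/33))) r.domain)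
    (hd' : r'.domain = {x | ∀ i, x i ∈ Set.Ioo (0:ℝ) 1})
    (hi' : Set.EqOn r'.integrand (fun x => c * ((x 0) ^ (-(32:ℝ)/33) * (1 - x 0) ^ (-(30:ℝ)/33) *
      ((x 1) ^ (-(31:ℝ)/33) * (1 - x 1) ^ (-(19:ℝ)/33)))) r'.domain)
    (hv : r.value = r'.value) : Equivalent r r' :=
  dasDeep33_of_solvedPair66 hM hB (pair66_of_betaLinearSector hL) c hc r r' hd hi hd' hi' hv

/-- **DasDeepThirtyThree from the level-66 isogeny pair as a bare KZ statement**, 12305 and 13633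
— the card's transfer shape `DeepThirtyThreeFromSixtySix` (its `EulerReflectionRational`
hypothesis is PROVED in the tree and dropped). [folklore] -/
theorem dasDeep33_of_isogenyPair (hM : MultiplicationAccessible) (hB : BetaCancellation)
    (hI : ∀ (c : ℝ), IsAlgebraic ℚ c → ∀ (r r' : IntegralRep 1),
      r.domain = {t | t 0 ∈ Set.Ioo (0:ℝ) 1} →
      Set.EqOn r.integrand (fun t => (t 0) ^ (-(21:ℝ)/22) * (1 - t 0) ^ (-(2:ℝ)/3)) r.domain →
      r'.domain = {t | t 0 ∈ Set.Ioo (0:ℝ) 1} →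
      Set.EqOn r'.integrand (fun t => c * ((t 0) ^ (-(21:ℝ)/22) * (1 - t 0) ^ (-(17:ℝ)/33))) r'.domain →
      r.value = r'.value → Equivalent r r')
    (c : ℝ) (hc : IsAlgebraic ℚ c) (r r' : IntegralRep 2)
    (hd : r.domain = {x | ∀ i, x i ∈ Set.Ioo (0:ℝ) 1})
    (hi : Set.EqOn r.integrand (fun x => (x 0) ^ (-(32:ℝ)/33) * (1 - x 0) ^ (-(32:ℝ)/33) *
      ((x 1) ^ (-(31:ℝ)/33) * (1 - x 1) ^ (-(11:ℝ)/33))) r.domain)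
    (hd' : r'.domain = {x | ∀ i, x i ∈ Set.Ioo (0:ℝ) 1})
    (hi' : Set.EqOn r'.integrand (fun x => c * ((x 0) ^ (-(32:ℝ)/33) * (1 - x 0) ^ (-(30:ℝ)/33) *
      ((x 1) ^ (-(31:ℝ)/33) * (1 - x 1) ^ (-(19:ℝ)/33)))) r'.domain)
    (hv : r.value = r'.value) : Equivalent r r' :=
  dasDeep33_of_solvedPair66 hM hB (pair66_of_isogenyPair hI) c hc r r' hd hi hd' hi' hv

/-- **The Fermat-33 certificate instance from the Beta-linear sector** (3897), 12305 and 13633. [folklore] -/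
theorem fermat33_of_betaLinearSector (hL : BetaLinearSector) (hM : MultiplicationAccessible)
    (hB : BetaCancellation) :
    Equivalent (cubeRep x33 y33 admissible_fermat33.pos)
      (ballCubeRep 3 Fin.elim0 Fin.elim0 c33 isAlgebraic_c33 admissible_elim0.pos) :=
  fermat33_of_solvedPair66 hM hB (pair66_of_betaLinearSector hL)

/-- **The Fermat-33 certificate instance from the level-66 isogeny pair as a bare KZ statement**,
12305 and 13633: da Silva's period relation on `X⁴₃₃` inside the calculus costs ONE curve
correspondence at level 66, not a fourfold cycle. [folklore] -/
theorem fermat33_of_isogenyPair (hM : MultiplicationAccessible) (hB : BetaCancellation)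
    (hI : ∀ (c : ℝ), IsAlgebraic ℚ c → ∀ (r r' : IntegralRep 1),
      r.domain = {t | t 0 ∈ Set.Ioo (0:ℝ) 1} →
      Set.EqOn r.integrand (fun t => (t 0) ^ (-(21:ℝ)/22) * (1 - t 0) ^ (-(2:ℝ)/3)) r.domain →
      r'.domain = {t | t 0 ∈ Set.Ioo (0:ℝ) 1} →
      Set.EqOn r'.integrand (fun t => c * ((t 0) ^ (-(21:ℝ)/22) * (1 - t 0) ^ (-(17:ℝ)/33))) r'.domain →
      r.value = r'.value → Equivalent r r') :
    Equivalent (cubeRep x33 y33 admissible_fermat33.pos)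
      (ballCubeRep 3 Fin.elim0 Fin.elim0 c33 isAlgebraic_c33 admissible_elim0.pos) :=
  fermat33_of_solvedPair66 hM hB (pair66_of_isogenyPair hI)

/-- **Conversely the crux yields the pair** (through its divisor range), so modulo 12305 ∧ 13633 the two
level-33 instances are EQUIVALENT consequences of the single level-66 pair: nothing deeper is in them.
[folklore] -/
theorem pair66_of_gammaHodgeSector (h : GammaHodgeSector) :
    IsConstMultiple (betaClass (1/22) (1/3)) (betaClass (1/22) (16/33)) :=
  stub_pair66_of_gammaHodgePairs (gammaHodgePairs_of_gammaHodgeSector h)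

end Summit.KontsevichZagierPeriods.GammaHodgeSectorRaise66

end
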